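import Literature.AlgebraicGeometry.Hu2025.Proofs.S06WpEllBlowups.R107Claims

/-!
# Hu 2025 (arXiv:2507.21400v1) §6.2.1 AS TYPED in lit/PARTITION-HU.md row 107 — «canonical»: the TESTS DETERMINE THE RUN
# (kernel certificate for the word «canonical» in C43L131–L133 «We need a total ordering on the set Φ_{℘_(kτ)𝔯_μ} … to
# produce a canonical sequential blowups»), by res-type-018 (gen 5)

What is proved here, and nothing more. Row 107 types §6.1–§6.2 RELATIVE to the geometric tests (`meetsV`, Def. 6.4/6.7) as a
datum `R : WpRun` subject to `R.IsAsPrinted ltP gov later meetsV` (file `S06WpEllBlowups/R107cWpEllBlowups.lean`). This file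
shows that the packaging DEFINES rather than merely constrains the blow-up sequence: if two runs `R`, `R'` both satisfy
`IsAsPrinted` for the same order `ltP` on the Plücker variables (assumed ASYMMETRIC — Def. 3.14/3.15, row 102), the same
embedding `gov` and scope `later` (assumed to declare the governing binomial of every LATER block «later»: `j < k ⇒ later j
(gov (kτ))`, which is what Def. 6.9's «B ∈ 𝓑^gov_G ⊔ 𝓑^𝔯𝔟 with G > F_k» says for governing binomials) and the same tests, then
`R.rho = R'.rho`, and `σ_(kτ)μ`, `ϕ_(kτ)μh` agree on every live index: the number of rounds, the number of ℘-sets per round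
and EVERY ℘-centre, in order, are functions of the tests alone. (The multiplicity tables agree on the columns the construction
reads; columns the print leaves unconstrained — e.g. `𝓑^𝔯𝔟`-columns at `E_{ℓ_k}` outside `later` — are not claimed.)
Also (section `Listing`): Def. 6.5's order is TRANSITIVE (`Def6_5_phiLT_trans`, given a transitive Plücker order), so the
listing of a round EXISTS whenever the name set is finite and distinct ℘-sets compare (`exists_isPhiListing`; for a run with
Def. 6.1's initial package and a strict total Plücker order: `exists_isPhiListing_of_initial`) — with `IsPhiListing.unique`,
C44L28 «Thus, we can list Φ_{℘_(kτ)𝔯_μ} as {ϕ_(kτ)μ1 < ⋯ < ϕ_(kτ)μσ}» is well defined AS TYPED.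
Also (section `OneRun`, API for rows 108/110): for ONE run as printed, Def. 6.7's infimum is attained (`rho_spec`: no pre-℘-set
of round `ρ+1` passes), every live round has a ℘-set (`round_has_wpSet`) so `σ_(kτ)μ ≥ 1` (`sigma_pos`, C44L32 «finite positive
integer»), and each listed centre `ϕ_(kτ)μh` passes its test with both names in `𝒟_{(℘_(kτ)𝔯_{μ−1})}` (`phi_spec`).
A certificate about the TYPED packaging; it says nothing else about the manuscript. Source status: UNREFEREED PREPRINT UNDER
ADJUDICATION (D-0012/D-0089); AI typing, weaker than expert review; HONEST CEILING as in lit/PARTITION-HU.md.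

## Sources
* Y. Hu, *Universal Characteristic-free Resolution of Singularities, I*, arXiv:2507.21400v1 (2025), §6.2.1, chunks p0043 l.92 –
  p0046 l.15 (PDF pp.99–103). [Hu2025] (ADJUDICATED, not cited as fact)
-/

namespace Literature.AlgebraicGeometry.Hu2025.Statements.S06WpEllBlowups

universe u v w

variable {P : Type v} {Λ : Type v} (W : WpFrame P Λ)

/-! ## Asymmetry of Def. 6.5's orders; a pre-℘-set is its pair of names -/

/-- Extensionality for pre-℘-sets: equal names, equal pre-℘-set (the other fields are proofs).
[cite: Hu2025, §6.2 Def. 6.5–6.9, pp. 99–106 (unrefereed preprint arXiv:2507.21400v1 under adjudication, D-0012/D-0089 — kernel support on OUR typed carrier of row 107; nothing of the source asserted)] -/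
theorem PreWpSet.ext' {𝒟 : Set W.Div} {m : W.Div → Fin 2 → ℕ} {φ ψ : PreWpSet W 𝒟 m}
    (h₁ : φ.plus = ψ.plus) (h₂ : φ.minus = ψ.minus) : φ = ψ := by
  rcases φ with ⟨p, q, _, _, _, _, _⟩
  rcases ψ with ⟨p', q', _, _, _, _, _⟩
  cases h₁; cases h₂; rfl

namespace WpFrame

variable {W}

/-- `Stage.LT` is asymmetric (from transitivity and irreflexivity, `R107Claims`).
[cite: Hu2025, §6.2 Def. 6.5–6.9, pp. 99–106 (unrefereed preprint arXiv:2507.21400v1 under adjudication, D-0012/D-0089 — kernel support on OUR typed carrier of row 107; nothing of the source asserted)] -/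
theorem Stage.LT_asymm {a b : W.Stage} (h : Stage.LT a b) : ¬ Stage.LT b a :=
  fun h' => Stage.LT_irrefl a (Stage.LT_trans a b a h h')

/-- «order of occurrence» is asymmetric.
[cite: Hu2025, §6.2 Def. 6.5–6.9, pp. 99–106 (unrefereed preprint arXiv:2507.21400v1 under adjudication, D-0012/D-0089 — kernel support on OUR typed carrier of row 107; nothing of the source asserted)] -/
theorem Div.occLT_asymm {Y Y' : W.Div} (h : Div.OccLT Y Y') : ¬ Div.OccLT Y' Y := by
  rintro h'
  obtain ⟨a, b, ha, hb, hab⟩ := h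
  obtain ⟨b', a', hb', ha', hba⟩ := h'
  have eb : b' = b := Option.some.inj (hb'.symm.trans hb)
  have ea : a' = a := Option.some.inj (ha'.symm.trans ha)
  subst eb; subst ea
  rcases hab with hab | ⟨ha0, hb0, j, j', hYj, hY'j', hjj⟩
  · rcases hba with hba | ⟨hb0, ha0, i, i', -, -, -⟩
    · exact Stage.LT_asymm hab hba
    · rw [ha0, hb0] at hab; exact Stage.LT_irrefl _ hab
  · rcases hba with hba | ⟨-, -, i, i', hY'i, hYi', hii⟩
    · rw [ha0, hb0] at hba; exact Stage.LT_irrefl _ hba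
    · have e1 : j = i' := by
        have := hYj.symm.trans hYi'; simpa [Div.excTheta] using this
      have e2 : j' = i := by
        have := hY'j'.symm.trans hY'i; simpa [Div.excTheta] using this
      subst e1; subst e2
      exact lt_asymm hjj hii

/-- ϖ-names are not exceptional. Plumbing.
[cite: Hu2025, §6.2 Def. 6.5–6.9, pp. 99–106 (unrefereed preprint arXiv:2507.21400v1 under adjudication, D-0012/D-0089 — kernel support on OUR typed carrier of row 107; nothing of the source asserted)] -/
theorem Div.isVarpi_isExceptional {Y : W.Div} (h1 : Div.IsVarpi Y) (h2 : Div.IsExceptional Y) : False := by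
  rcases Y with ((a | a) | a) | a <;> simp [Div.IsExceptional, Div.IsVarpi, Div.cases] at h1 h2

/-- `X_u` is a ϖ-name. Plumbing.
[cite: Hu2025, §6.2 Def. 6.5–6.9, pp. 99–106 (unrefereed preprint arXiv:2507.21400v1 under adjudication, D-0012/D-0089 — kernel support on OUR typed carrier of row 107; nothing of the source asserted)] -/
theorem Div.isVarpi_varpi (u : P) : Div.IsVarpi (W := W) (Div.varpi u) := by
  simp [Div.IsVarpi, Div.cases, Div.varpi]

/-- `u ↦ X_u` is injective. Plumbing.
[cite: Hu2025, §6.2 Def. 6.5–6.9, pp. 99–106 (unrefereed preprint arXiv:2507.21400v1 under adjudication, D-0012/D-0089 — kernel support on OUR typed carrier of row 107; nothing of the source asserted)] -/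
theorem Div.varpi_inj {u u' : P} (h : (Div.varpi u : W.Div) = Div.varpi u') : u = u' := by
  simpa [Div.varpi] using h

/-- «order of occurrence» is irreflexive.
[cite: Hu2025, §6.2 Def. 6.5–6.9, pp. 99–106 (unrefereed preprint arXiv:2507.21400v1 under adjudication, D-0012/D-0089 — kernel support on OUR typed carrier of row 107; nothing of the source asserted)] -/
theorem Div.occLT_irrefl (Y : W.Div) : ¬ Div.OccLT Y Y := fun h => Div.occLT_asymm h h

/-- Def. 6.5's order on `𝒟⁺` is asymmetric.
[cite: Hu2025, §6.2 Def. 6.5–6.9, pp. 99–106 (unrefereed preprint arXiv:2507.21400v1 under adjudication, D-0012/D-0089 — kernel support on OUR typed carrier of row 107; nothing of the source asserted)] -/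
theorem Def6_5_plusLT_asymm (kτ : W.IndexBgov) {Y Y' : W.Div} (h : W.Def6_5_plusLT kτ Y Y') :
    ¬ W.Def6_5_plusLT kτ Y' Y := by
  rintro h'
  rcases h with ⟨h1, h2⟩ | ⟨h1, h2, h3⟩ | ⟨hx, hx', ho⟩ <;> rcases h' with ⟨h1', h2'⟩ | ⟨h1', h2', h3'⟩ | ⟨hy, hy', ho'⟩
  · exact h2 (h1'.trans h1.symm)
  · exact h3' h1
  · subst h1; simp [Div.IsExceptional, Div.cases, Div.varrho] at hy
  · exact h3 h1'
  · exact h2 (h1'.trans h1.symm)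
  · subst h1; simp [Div.IsExceptional, Div.cases, Div.varpi] at hy
  · subst h1'; simp [Div.IsExceptional, Div.cases, Div.varrho] at hx
  · subst h1'; simp [Div.IsExceptional, Div.cases, Div.varpi] at hx
  · exact Div.occLT_asymm ho ho'

/-- Def. 6.5's order on `𝒟⁻` is asymmetric, given an asymmetric Plücker order `ltP`.
[cite: Hu2025, §6.2 Def. 6.5–6.9, pp. 99–106 (unrefereed preprint arXiv:2507.21400v1 under adjudication, D-0012/D-0089 — kernel support on OUR typed carrier of row 107; nothing of the source asserted)] -/
theorem Def6_5_minusLT_asymm (ltP : P → P → Prop) (hlt : ∀ u u', ltP u u' → ¬ ltP u' u) {Y Y' : W.Div}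
    (h : W.Def6_5_minusLT ltP Y Y') : ¬ W.Def6_5_minusLT ltP Y' Y := by
  rintro h'
  rcases h with ⟨hx, hx', ho⟩ | ⟨hx, hv'⟩ | ⟨u, u', hu, hu', huu⟩ <;>
    rcases h' with ⟨hy, hy', ho'⟩ | ⟨hy, hv⟩ | ⟨w, w', hw, hw', hww⟩
  · exact Div.occLT_asymm ho ho'
  · exact Div.isVarpi_isExceptional hv hx
  · exact Div.isVarpi_isExceptional (by rw [hw']; exact Div.isVarpi_varpi w') hx
  · exact Div.isVarpi_isExceptional hv' hy
  · exact Div.isVarpi_isExceptional hv hx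
  · exact Div.isVarpi_isExceptional (by rw [hw']; exact Div.isVarpi_varpi w') hx
  · exact Div.isVarpi_isExceptional (by rw [hu]; exact Div.isVarpi_varpi u) hy'
  · exact Div.isVarpi_isExceptional (by rw [hu']; exact Div.isVarpi_varpi u') hy
  · have e1 : u = w' := Div.varpi_inj (hu.symm.trans hw')
    have e2 : u' = w := Div.varpi_inj (hu'.symm.trans hw)
    subst e1; subst e2
    exact hlt _ _ huu hww

/-- Def. 6.5's order on the ℘-sets is asymmetric, given an asymmetric Plücker order `ltP`.
[cite: Hu2025, §6.2 Def. 6.5–6.9, pp. 99–106 (unrefereed preprint arXiv:2507.21400v1 under adjudication, D-0012/D-0089 — kernel support on OUR typed carrier of row 107; nothing of the source asserted)] -/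
theorem Def6_5_phiLT_asymm (ltP : P → P → Prop) (hlt : ∀ u u', ltP u u' → ¬ ltP u' u) (kτ : W.IndexBgov)
    {𝒟 : Set W.Div} {m : W.Div → Fin 2 → ℕ} {φ₁ φ₂ : PreWpSet W 𝒟 m} (h : W.Def6_5_phiLT ltP kτ φ₁ φ₂) :
    ¬ W.Def6_5_phiLT ltP kτ φ₂ φ₁ := by
  rintro h'
  rcases h with h | ⟨he, h⟩ <;> rcases h' with h' | ⟨he', h'⟩
  · exact W.Def6_5_plusLT_asymm kτ h h'
  · rw [he'] at h; exact W.Def6_5_plusLT_asymm kτ h h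
  · rw [he] at h'; exact W.Def6_5_plusLT_asymm kτ h' h'
  · exact W.Def6_5_minusLT_asymm ltP hlt h h'

/-! ## The listing of a round is unique (Def. 6.5's order is asymmetric) -/

/-- Two lists that are chains for an asymmetric relation and have the same members are equal. Plumbing.
[cite: Hu2025, §6.2 Def. 6.5–6.9, pp. 99–106 (unrefereed preprint arXiv:2507.21400v1 under adjudication, D-0012/D-0089 — kernel support on OUR typed carrier of row 107; nothing of the source asserted)] -/
theorem list_eq_of_chain {α : Type*} (r : α → α → Prop) (hr : ∀ a b, r a b → ¬ r b a) :
    ∀ (L L' : List α), L.Pairwise r → L'.Pairwise r → (∀ a, a ∈ L ↔ a ∈ L') → L = L'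
  | [], [], _, _, _ => rfl
  | [], b :: L', _, _, h => by have := (h b).mpr (by simp); simp at this
  | a :: L, [], _, _, h => by have := (h a).mp (by simp); simp at this
  | a :: L, b :: L', hL, hL', h => by
    rw [List.pairwise_cons] at hL hL'
    have hab : a = b := by
      by_contra hne
      have hb : b ∈ L := by
        have := (h b).mpr (by simp)
        rcases List.mem_cons.mp this with hba | hbL
        · exact (hne hba.symm).elim
        · exact hbL
      have ha : a ∈ L' := by
        have := (h a).mp (by simp)
        rcases List.mem_cons.mp this with hab | haL
        · exact (hne hab).elim
        · exact haL
      exact hr a b (hL.1 b hb) (hL'.1 a ha)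
    subst hab
    have haL : a ∉ L := fun haL => hr a a (hL.1 a haL) (hL.1 a haL)
    have haL' : a ∉ L' := fun haL' => hr a a (hL'.1 a haL') (hL'.1 a haL')
    congr 1
    refine list_eq_of_chain r hr L L' hL.2 hL'.2 fun c => ?_
    constructor
    · intro hc
      have := (h c).mp (List.mem_cons_of_mem a hc)
      rcases List.mem_cons.mp this with rfl | hcL'
      · exact (haL hc).elim
      · exact hcL'
    · intro hc
      have := (h c).mpr (List.mem_cons_of_mem a hc)
      rcases List.mem_cons.mp this with rfl | hcL
      · exact (haL' hc).elim
      · exact hcL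

/-- **The listing `Φ_{℘_(kτ)𝔯_μ} = {ϕ_(kτ)μ1 < ⋯ < ϕ_(kτ)μσ}` is UNIQUE** (given the name set, the column and the test): two
`IsPhiListing`s coincide, provided the Plücker order `ltP` is asymmetric.
[cite: Hu2025, §6.2 Def. 6.5–6.9, pp. 99–106 (unrefereed preprint arXiv:2507.21400v1 under adjudication, D-0012/D-0089 — kernel support on OUR typed carrier of row 107; nothing of the source asserted)] -/
theorem IsPhiListing.unique (ltP : P → P → Prop) (hlt : ∀ u u', ltP u u' → ¬ ltP u' u) (kτ : W.IndexBgov)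
    {𝒟 : Set W.Div} {m : W.Div → Fin 2 → ℕ} (meetsV : W.Div → W.Div → Prop) {L L' : List (PreWpSet W 𝒟 m)}
    (hL : W.IsPhiListing ltP kτ meetsV L) (hL' : W.IsPhiListing ltP kτ meetsV L') : L = L' := by
  refine list_eq_of_chain _ (fun φ ψ h h' => W.Def6_5_phiLT_asymm ltP hlt kτ h.1 h'.1) L L' hL.2 hL'.2 fun φ => ?_
  have key : ∀ {M : List (PreWpSet W 𝒟 m)}, W.IsPhiListing ltP kτ meetsV M → (φ ∈ M ↔ IsWpSet W meetsV φ) := by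
    intro M hM
    rw [hM.1 φ]
    constructor
    · intro h; exact ⟨φ, h, rfl, rfl⟩
    · rintro ⟨ψ, hψ, h1, h2⟩
      have : ψ = φ := PreWpSet.ext' W h1 h2
      rw [← this]; exact hψ
  rw [key hL, key hL']

end WpFrame

end Literature.AlgebraicGeometry.Hu2025.Statements.S06WpEllBlowups

/-! ## The tests determine the run: set-up of the induction -/

namespace Literature.AlgebraicGeometry.Hu2025.Statements.S06WpEllBlowups

namespace WpFrame

universe u₁ v₁ w₁

variable {P : Type v₁} {Λ : Type v₁} {W : WpFrame P Λ} {Bin : Type w₁}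

/-- Decoding a lexicographic comparison of two four-letter keys. Plumbing.
[cite: Hu2025, §6.2 Def. 6.5–6.9, pp. 99–106 (unrefereed preprint arXiv:2507.21400v1 under adjudication, D-0012/D-0089 — kernel support on OUR typed carrier of row 107; nothing of the source asserted)] -/
theorem lex4_cases {a b c d a' b' c' d' : ℕ} (h : List.Lex (· < ·) [a, b, c, d] [a', b', c', d']) :
    a < a' ∨ (a = a' ∧ (b < b' ∨ (b = b' ∧ (c < c' ∨ (c = c' ∧ d < d'))))) := by
  cases h with
  | rel h => exact Or.inl h
  | cons h =>
    refine Or.inr ⟨rfl, ?_⟩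
    cases h with
    | rel h => exact Or.inl h
    | cons h =>
      refine Or.inr ⟨rfl, ?_⟩
      cases h with
      | rel h => exact Or.inl h
      | cons h =>
        refine Or.inr ⟨rfl, ?_⟩
        cases h with
        | rel h => exact h
        | cons h => cases h

/-- The lexicographic order on (block-relation index, round): `(k',τ',μ') <lex (k,τ,μ)`.
[cite: Hu2025, §6.2 Def. 6.5–6.9, pp. 99–106 (unrefereed preprint arXiv:2507.21400v1 under adjudication, D-0012/D-0089 — kernel support on OUR typed carrier of row 107; nothing of the source asserted)] -/
def LexLT (W : WpFrame P Λ) (a b : W.IndexBgov × ℕ) : Prop :=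
  a.1.1 < b.1.1 ∨ (a.1.1 = b.1.1 ∧ (a.1.2.val < b.1.2.val ∨ (a.1.2.val = b.1.2.val ∧ a.2 < b.2)))

/-- What «the runs `R`, `R'` agree on round `μ` of `B_(kτ)`» means: the round is live for one iff for the other, and when it
is, `σ_(kτ)μ`, every `ϕ_(kτ)μh` and the multiplicities of every new name `E_{(kτ)μh}` — in the columns `gov κ` of the blocks
`κ.1 ≥ kτ.1` (the ones the construction reads later) and in the whole `s`-table — coincide.
[cite: Hu2025, §6.2 Def. 6.5–6.9, pp. 99–106 (unrefereed preprint arXiv:2507.21400v1 under adjudication, D-0012/D-0089 — kernel support on OUR typed carrier of row 107; nothing of the source asserted)] -/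
def RoundAgree (R R' : W.WpRun Bin) (gov : W.IndexBgov → Bin) (kτ : W.IndexBgov) (μ : ℕ) : Prop :=
  (μ ≤ R.rho kτ ↔ μ ≤ R'.rho kτ) ∧
  (1 ≤ μ → μ ≤ R.rho kτ →
    R.sigma kτ μ = R'.sigma kτ μ ∧
    ∀ h, 1 ≤ h → h ≤ R.sigma kτ μ →
      R.phi kτ μ h = R'.phi kτ μ h ∧
      (∀ κ : W.IndexBgov, kτ.1 ≤ κ.1 → ∀ i, R.tabB (Div.excWpOf kτ μ h) (gov κ) i = R'.tabB (Div.excWpOf kτ μ h) (gov κ) i) ∧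
      ∀ s, R.tabS (Div.excWpOf kτ μ h) s = R'.tabS (Div.excWpOf kτ μ h) s)

/-- `RoundAgree` is symmetric in the two runs.
[cite: Hu2025, §6.2 Def. 6.5–6.9, pp. 99–106 (unrefereed preprint arXiv:2507.21400v1 under adjudication, D-0012/D-0089 — kernel support on OUR typed carrier of row 107; nothing of the source asserted)] -/
theorem RoundAgree.symm {R R' : W.WpRun Bin} {gov : W.IndexBgov → Bin} {kτ : W.IndexBgov} {μ : ℕ}
    (h : RoundAgree R R' gov kτ μ) : RoundAgree R' R gov kτ μ := by
  refine ⟨h.1.symm, fun h1 hμ => ?_⟩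
  have hμR : μ ≤ R.rho kτ := h.1.mpr hμ
  obtain ⟨hσ, hh⟩ := h.2 h1 hμR
  refine ⟨hσ.symm, fun n hn hn' => ?_⟩
  obtain ⟨hφ, hT, hS⟩ := hh n hn (hσ ▸ hn')
  exact ⟨hφ.symm, fun κ hκ i => (hT κ hκ i).symm, fun s => (hS s).symm⟩

/-- Transport of a pre-℘-set along equal name sets and columns that agree on the name set. Plumbing.
[cite: Hu2025, §6.2 Def. 6.5–6.9, pp. 99–106 (unrefereed preprint arXiv:2507.21400v1 under adjudication, D-0012/D-0089 — kernel support on OUR typed carrier of row 107; nothing of the source asserted)] -/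
def PreWpSet.transfer {𝒟 𝒟' : Set W.Div} {m m' : W.Div → Fin 2 → ℕ} (h𝒟 : ∀ Y, Y ∈ 𝒟 → Y ∈ 𝒟')
    (hm : ∀ Y, Y ∈ 𝒟 → ∀ i, m Y i = m' Y i) (φ : PreWpSet W 𝒟 m) : PreWpSet W 𝒟' m' where
  plus := φ.plus
  minus := φ.minus
  plus_mem := h𝒟 _ φ.plus_mem
  minus_mem := h𝒟 _ φ.minus_mem
  plus_assoc := by
    have := φ.plus_assoc
    unfold IsAssociated at this ⊢
    rwa [← hm _ φ.plus_mem]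
  minus_assoc := by
    have := φ.minus_assoc
    unfold IsAssociated at this ⊢
    rwa [← hm _ φ.minus_mem]
  plus_ne_minus := φ.plus_ne_minus

/-- `transfer` keeps `Y⁺`.
[cite: Hu2025, §6.2 Def. 6.5–6.9, pp. 99–106 (unrefereed preprint arXiv:2507.21400v1 under adjudication, D-0012/D-0089 — kernel support on OUR typed carrier of row 107; nothing of the source asserted)] -/
theorem PreWpSet.transfer_plus {𝒟 𝒟' : Set W.Div} {m m' : W.Div → Fin 2 → ℕ} (h𝒟 : ∀ Y, Y ∈ 𝒟 → Y ∈ 𝒟')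
    (hm : ∀ Y, Y ∈ 𝒟 → ∀ i, m Y i = m' Y i) (φ : PreWpSet W 𝒟 m) : (PreWpSet.transfer h𝒟 hm φ).plus = φ.plus := rfl

/-- `transfer` keeps `Y⁻`.
[cite: Hu2025, §6.2 Def. 6.5–6.9, pp. 99–106 (unrefereed preprint arXiv:2507.21400v1 under adjudication, D-0012/D-0089 — kernel support on OUR typed carrier of row 107; nothing of the source asserted)] -/
theorem PreWpSet.transfer_minus {𝒟 𝒟' : Set W.Div} {m m' : W.Div → Fin 2 → ℕ} (h𝒟 : ∀ Y, Y ∈ 𝒟 → Y ∈ 𝒟')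
    (hm : ∀ Y, Y ∈ 𝒟 → ∀ i, m Y i = m' Y i) (φ : PreWpSet W 𝒟 m) : (PreWpSet.transfer h𝒟 hm φ).minus = φ.minus := rfl

/-- A listing transported along equal name sets / agreeing columns is again a listing (the order and the test read names
only). Plumbing.
[cite: Hu2025, §6.2 Def. 6.5–6.9, pp. 99–106 (unrefereed preprint arXiv:2507.21400v1 under adjudication, D-0012/D-0089 — kernel support on OUR typed carrier of row 107; nothing of the source asserted)] -/
theorem IsPhiListing.transfer [DecidableEq P] [DecidableEq Λ] (ltP : P → P → Prop) (kτ : W.IndexBgov)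
    (meetsV : W.Div → W.Div → Prop)
    {𝒟 𝒟' : Set W.Div} {m m' : W.Div → Fin 2 → ℕ} (h𝒟 : ∀ Y, Y ∈ 𝒟 ↔ Y ∈ 𝒟')
    (hm : ∀ Y, Y ∈ 𝒟 → ∀ i, m Y i = m' Y i) {L : List (PreWpSet W 𝒟 m)} (hL : W.IsPhiListing ltP kτ meetsV L) :
    W.IsPhiListing ltP kτ meetsV
      (L.map (PreWpSet.transfer (fun Y h => (h𝒟 Y).mp h) hm)) := by
  have h𝒟' : ∀ Y, Y ∈ 𝒟' → Y ∈ 𝒟 := fun Y h => (h𝒟 Y).mpr h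
  have hm' : ∀ Y, Y ∈ 𝒟' → ∀ i, m' Y i = m Y i := fun Y h i => (hm Y (h𝒟' Y h) i).symm
  refine ⟨fun φ' => ?_, ?_⟩
  · -- exactly the ℘-sets
    have := hL.1 (PreWpSet.transfer h𝒟' hm' φ')
    simp only [IsWpSet, PreWpSet.transfer_plus, PreWpSet.transfer_minus] at this ⊢
    rw [this]
    simp only [List.mem_map]
    constructor
    · rintro ⟨ψ, hψ, h1, h2⟩
      exact ⟨PreWpSet.transfer _ hm ψ, ⟨ψ, hψ, rfl⟩, h1, h2⟩
    · rintro ⟨ψ', ⟨ψ, hψ, rfl⟩, h1, h2⟩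
      exact ⟨ψ, hψ, h1, h2⟩
  · -- increasing
    rw [List.pairwise_map]
    exact hL.2.imp fun {φ₁ φ₂} h => h

/-! ## (A) Liveness and the name sets transfer along agreement on earlier rounds -/

section Transfer

variable {R R' : W.WpRun Bin} {gov : W.IndexBgov → Bin}

/-- Liveness of a ℘-name born before round `μ` of `B_(kτ)` transfers, given agreement on all lexicographically earlier
rounds.
[cite: Hu2025, §6.2 Def. 6.5–6.9, pp. 99–106 (unrefereed preprint arXiv:2507.21400v1 under adjudication, D-0012/D-0089 — kernel support on OUR typed carrier of row 107; nothing of the source asserted)] -/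
theorem live_transfer (kτ : W.IndexBgov) (μ : ℕ)
    (IH : ∀ kτ' μ', LexLT W (kτ', μ') (kτ, μ) → RoundAgree R R' gov kτ' μ')
    (x : Fin W.N × ℕ × ℕ × ℕ)
    (hlt : Stage.LT (Stage.wp x.1 x.2.1 x.2.2.1 x.2.2.2 : W.Stage) (Stage.wp kτ.1 (kτ.2.val + 1) μ 1))
    (hx : W.IsIndexPhi R.rho R.sigma x.1 x.2.1 x.2.2.1 x.2.2.2) :
    W.IsIndexPhi R'.rho R'.sigma x.1 x.2.1 x.2.2.1 x.2.2.2 := by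
  obtain ⟨τ'', hτ, h1, h2, h3, h4⟩ := hx
  have key : LexLT W (⟨x.1, τ''⟩, x.2.2.1) (kτ, μ) := by
    have hl := lex4_cases (by simpa [Stage.LT, Stage.wp, Stage.key] using hlt)
    rcases hl with hk | ⟨hk, hrest⟩
    · exact Or.inl hk
    · refine Or.inr ⟨Fin.ext hk, ?_⟩
      rcases hrest with hτ' | ⟨hτ', hrest⟩
      · left; simp only; omega
      · right
        refine ⟨by simp only; omega, ?_⟩
        rcases hrest with hμ | ⟨-, hh⟩
        · exact hμ
        · omega
  have RA := IH _ _ key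
  refine ⟨τ'', hτ, h1, RA.1.mp h2, h3, ?_⟩
  rw [← (RA.2 h1 h2).1]; exact h4

/-- (A') The name sets `𝒟_{(℘_(kτ)𝔯_{μ−1})}` of the two runs coincide, given agreement on all earlier rounds.
[cite: Hu2025, §6.2 Def. 6.5–6.9, pp. 99–106 (unrefereed preprint arXiv:2507.21400v1 under adjudication, D-0012/D-0089 — kernel support on OUR typed carrier of row 107; nothing of the source asserted)] -/
theorem divsBefore_transfer (kτ : W.IndexBgov) (μ : ℕ)
    (IH : ∀ kτ' μ', LexLT W (kτ', μ') (kτ, μ) → RoundAgree R R' gov kτ' μ')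
    (Y : W.Div) (hY : Y ∈ W.divsBefore R.rho R.sigma kτ μ) : Y ∈ W.divsBefore R'.rho R'.sigma kτ μ := by
  obtain ⟨hlive, hrest⟩ := hY
  refine ⟨?_, hrest⟩
  rcases Y with ((w | r) | l) | j | x | e
  all_goals try trivial
  · -- ℘-name: live iff its round is live and `h ≤ σ`
    simp only [Div.IsLive, Div.cases, Sum.elim_inl, Sum.elim_inr] at hlive ⊢
    rcases hrest with hθ | ⟨b, hb, hblt⟩
    · -- a ℘-name is not in 𝒟_ϑ
      rcases hθ with (⟨w, hw⟩ | ⟨r, hr⟩) | ⟨j, hj⟩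
      · simp [Div.varpi] at hw
      · simp [Div.varrho] at hr
      · simp [Div.excTheta] at hj
    · have hb' : b = Stage.wp x.1 x.2.1 x.2.2.1 x.2.2.2 := by
        have : Div.birth (W := W) (Sum.inr (Sum.inr (Sum.inl x))) = some (Stage.wp x.1 x.2.1 x.2.2.1 x.2.2.2) := rfl
        rw [this] at hb; exact (Option.some.inj hb).symm
      subst hb'
      exact live_transfer kτ μ IH x hblt hlive

/-- The name sets `𝒟_{(℘_(kτ)𝔯_{μ−1})}` of the two runs coincide, given agreement on all earlier rounds.
[cite: Hu2025, §6.2 Def. 6.5–6.9, pp. 99–106 (unrefereed preprint arXiv:2507.21400v1 under adjudication, D-0012/D-0089 — kernel support on OUR typed carrier of row 107; nothing of the source asserted)] -/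
theorem mem_divsBefore_iff (kτ : W.IndexBgov) (μ : ℕ)
    (IH : ∀ kτ' μ', LexLT W (kτ', μ') (kτ, μ) → RoundAgree R R' gov kτ' μ') (Y : W.Div) :
    Y ∈ W.divsBefore R.rho R.sigma kτ μ ↔ Y ∈ W.divsBefore R'.rho R'.sigma kτ μ :=
  ⟨divsBefore_transfer kτ μ IH Y,
   divsBefore_transfer (R := R') (R' := R) kτ μ (fun kτ' μ' h => (IH kτ' μ' h).symm) Y⟩

end Transfer

/-! ## The main induction -/

section Main

variable [DecidableEq P] [DecidableEq Λ]
variable (R R' : W.WpRun Bin) (ltP : P → P → Prop) (gov : W.IndexBgov → Bin) (later : Fin W.N → Bin → Prop)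
  (meetsV : W.IndexBgov → ℕ → W.Div → W.Div → Prop)

/-- Hypotheses of the canonicity theorem, bundled: both runs are as printed, `ltP` is asymmetric, and the governing binomials
of later blocks are «later» (Def. 6.9's scope).
[cite: Hu2025, §6.2 Def. 6.5–6.9, pp. 99–106 (unrefereed preprint arXiv:2507.21400v1 under adjudication, D-0012/D-0089 — kernel support on OUR typed carrier of row 107; nothing of the source asserted)] -/
structure CanonHyp : Prop where
  hR : R.IsAsPrinted ltP gov later meetsV
  hR' : R'.IsAsPrinted ltP gov later meetsV
  hlt : ∀ u u', ltP u u' → ¬ ltP u' u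
  hlater : ∀ (j : Fin W.N) (κ : W.IndexBgov), j < κ.1 → later j (gov κ)

variable {R R' ltP gov later meetsV}

/-- The hypotheses are symmetric in the two runs.
[cite: Hu2025, §6.2 Def. 6.5–6.9, pp. 99–106 (unrefereed preprint arXiv:2507.21400v1 under adjudication, D-0012/D-0089 — kernel support on OUR typed carrier of row 107; nothing of the source asserted)] -/
theorem CanonHyp.symm (H : CanonHyp R R' ltP gov later meetsV) : CanonHyp R' R ltP gov later meetsV :=
  ⟨H.hR', H.hR, H.hlt, H.hlater⟩

/-- The five clauses of `IsAsPrinted`, by name. Plumbing.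
[cite: Hu2025, §6.2 Def. 6.5–6.9, pp. 99–106 (unrefereed preprint arXiv:2507.21400v1 under adjudication, D-0012/D-0089 — kernel support on OUR typed carrier of row 107; nothing of the source asserted)] -/
theorem CanonHyp.a (H : CanonHyp R R' ltP gov later meetsV) :
    ∀ Y ∈ W.divsTheta, (∀ kτ i, R.tabB Y (gov kτ) i = Def6_1 W Y kτ i) ∧ ∀ s, R.tabS Y s = Def6_3_ours W Y s := H.hR.1
/-- Clause (b) of `IsAsPrinted` for `R`.
[cite: Hu2025, §6.2 Def. 6.5–6.9, pp. 99–106 (unrefereed preprint arXiv:2507.21400v1 under adjudication, D-0012/D-0089 — kernel support on OUR typed carrier of row 107; nothing of the source asserted)] -/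
theorem CanonHyp.b (H : CanonHyp R R' ltP gov later meetsV) :
    ∀ (kτ : W.IndexBgov) (μ : ℕ), 1 ≤ μ → μ ≤ R.rho kτ →
      ∃ L : List (PreWpSet W (W.divsBefore R.rho R.sigma kτ μ) (R.col gov kτ)),
        W.IsPhiListing ltP kτ (meetsV kτ (μ - 1)) L ∧ L.length = R.sigma kτ μ ∧
        ∀ (h : ℕ) (hh : h < L.length), R.phi kτ μ (h + 1) = ((L.get ⟨h, hh⟩).plus, (L.get ⟨h, hh⟩).minus) := H.hR.2.1
/-- Clause (c) of `IsAsPrinted` for `R`.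
[cite: Hu2025, §6.2 Def. 6.5–6.9, pp. 99–106 (unrefereed preprint arXiv:2507.21400v1 under adjudication, D-0012/D-0089 — kernel support on OUR typed carrier of row 107; nothing of the source asserted)] -/
theorem CanonHyp.c (H : CanonHyp R R' ltP gov later meetsV) :
    ∀ (kτ : W.IndexBgov) (μ h : ℕ), W.IsIndexPhi R.rho R.sigma kτ.1 (kτ.2.val + 1) μ h →
      (∀ B i, R.tabB (Div.excWpOf kτ μ h) B i = W.Def6_6_exc R.tabB (R.phi kτ μ h).1 (R.phi kτ μ h).2 B i) ∧
      (∀ s, R.tabS (Div.excWpOf kτ μ h) s = W.Def6_6_excS R.tabS (R.phi kτ μ h).1 (R.phi kτ μ h).2 s) := H.hR.2.2.1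
/-- Clause (d) of `IsAsPrinted` for `R`.
[cite: Hu2025, §6.2 Def. 6.5–6.9, pp. 99–106 (unrefereed preprint arXiv:2507.21400v1 under adjudication, D-0012/D-0089 — kernel support on OUR typed carrier of row 107; nothing of the source asserted)] -/
theorem CanonHyp.d (H : CanonHyp R R' ltP gov later meetsV) :
    ∀ kτ : W.IndexBgov, (R.rho kτ : ℕ∞) =
      Def6_7 W (fun μ => W.divsBefore R.rho R.sigma kτ (μ + 1)) (fun _ => R.col gov kτ) (fun μ => meetsV kτ μ) :=
  H.hR.2.2.2.1
/-- Clause (e) of `IsAsPrinted` for `R`.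
[cite: Hu2025, §6.2 Def. 6.5–6.9, pp. 99–106 (unrefereed preprint arXiv:2507.21400v1 under adjudication, D-0012/D-0089 — kernel support on OUR typed carrier of row 107; nothing of the source asserted)] -/
theorem CanonHyp.e (H : CanonHyp R R' ltP gov later meetsV) :
    ∀ k : Fin W.N, (∀ B, later k B → ∀ i, R.tabB (Div.excEll k) B i = R.tabB (Div.excTheta k) B i) ∧
      ∀ s, R.tabS (Div.excEll k) s = R.tabS (Div.excTheta k) s := H.hR.2.2.2.2

/-- (B) On `𝒟_{(℘_(kτ)𝔯_{μ−1})}` the two runs' tables agree in every column `gov κ` of a block `κ.1 ≥ kτ.1` and in the whole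
`s`-table, given agreement on all earlier rounds.
[cite: Hu2025, §6.2 Def. 6.5–6.9, pp. 99–106 (unrefereed preprint arXiv:2507.21400v1 under adjudication, D-0012/D-0089 — kernel support on OUR typed carrier of row 107; nothing of the source asserted)] -/
theorem col_agree (H : CanonHyp R R' ltP gov later meetsV) (kτ : W.IndexBgov) (μ : ℕ)
    (IH : ∀ kτ' μ', LexLT W (kτ', μ') (kτ, μ) → RoundAgree R R' gov kτ' μ')
    (Y : W.Div) (hY : Y ∈ W.divsBefore R.rho R.sigma kτ μ) :
    (∀ κ : W.IndexBgov, kτ.1 ≤ κ.1 → ∀ i, R.tabB Y (gov κ) i = R'.tabB Y (gov κ) i) ∧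
      ∀ s, R.tabS Y s = R'.tabS Y s := by
  obtain ⟨hlive, hrest⟩ := hY
  -- names of 𝒟_ϑ: clause (a) of both runs
  have caseTheta : Y ∈ W.divsTheta →
      (∀ κ : W.IndexBgov, kτ.1 ≤ κ.1 → ∀ i, R.tabB Y (gov κ) i = R'.tabB Y (gov κ) i) ∧ ∀ s, R.tabS Y s = R'.tabS Y s := by
    intro hθ
    obtain ⟨hA, hS⟩ := H.a Y hθ
    obtain ⟨hA', hS'⟩ := H.symm.a Y hθ
    exact ⟨fun κ _ i => by rw [hA κ i, hA' κ i], fun s => by rw [hS s, hS' s]⟩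
  rcases hrest with hθ | ⟨b, hb, hblt⟩
  · exact caseTheta hθ
  rcases Y with ((w | r) | l) | j | x | e
  · exact caseTheta (Or.inl (Or.inl ⟨w, rfl⟩))
  · exact caseTheta (Or.inl (Or.inr ⟨r, rfl⟩))
  · -- 𝔏-divisors have no birth stage
    exact absurd hb (by simp [Div.birth_inl])
  · exact caseTheta (Or.inr ⟨j, rfl⟩)
  · -- ℘-name: its own round is lexicographically earlier
    have hb' : b = Stage.wp x.1 x.2.1 x.2.2.1 x.2.2.2 := by
      have : Div.birth (W := W) (Sum.inr (Sum.inr (Sum.inl x))) = some (Stage.wp x.1 x.2.1 x.2.2.1 x.2.2.2) := rfl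
      rw [this] at hb; exact (Option.some.inj hb).symm
    subst hb'
    simp only [Div.IsLive, Div.cases, Sum.elim_inl, Sum.elim_inr] at hlive
    obtain ⟨τ'', hτ, h1, h2, h3, h4⟩ := hlive
    have hl := lex4_cases (by simpa [Stage.LT, Stage.wp, Stage.key] using hblt)
    have hk : x.1 ≤ kτ.1 := by
      rcases hl with hk | ⟨hk, -⟩
      · exact le_of_lt hk
      · exact le_of_eq (Fin.ext hk)
    have key : LexLT W (⟨x.1, τ''⟩, x.2.2.1) (kτ, μ) := by
      rcases hl with hk | ⟨hk, hrest⟩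
      · exact Or.inl hk
      · refine Or.inr ⟨Fin.ext hk, ?_⟩
        rcases hrest with hτ' | ⟨hτ', hrest⟩
        · left; simp only; omega
        · right
          refine ⟨by simp only; omega, ?_⟩
          rcases hrest with hμ | ⟨-, hh⟩
          · exact hμ
          · omega
    obtain ⟨-, hT, hS⟩ := ((IH _ _ key).2 h1 h2).2 x.2.2.2 h3 h4
    have hname : (Div.excWpOf (W := W) ⟨x.1, τ''⟩ x.2.2.1 x.2.2.2) = Sum.inr (Sum.inr (Sum.inl x)) := by
      rcases x with ⟨k', τ₀, μ', h'⟩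
      simp only at hτ
      simp [Div.excWpOf, Div.excWp, hτ]
    rw [hname] at hT hS
    exact ⟨fun κ hκ i => hT κ (le_trans hk hκ) i, hS⟩
  · -- ℓ-name `E_{ℓ_j}`, `j < kτ.1`: Def. 6.9 copies `E_{ϑ,j}` in the «later» columns
    have hb' : b = Stage.ellStage e := by
      have : Div.birth (W := W) (Sum.inr (Sum.inr (Sum.inr e))) = some (Stage.ellStage e) := rfl
      rw [this] at hb; exact (Option.some.inj hb).symm
    subst hb'
    have hj : e < kτ.1 := by simpa [Stage.LT, Stage.wp, Stage.ellStage] using hblt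
    obtain ⟨hE, hES⟩ := H.e e
    obtain ⟨hE', hES'⟩ := H.symm.e e
    obtain ⟨hA, hS⟩ := H.a (Div.excTheta e) (Or.inr ⟨e, rfl⟩)
    obtain ⟨hA', hS'⟩ := H.symm.a (Div.excTheta e) (Or.inr ⟨e, rfl⟩)
    refine ⟨fun κ hκ i => ?_, fun s => ?_⟩
    · have hlater : later e (gov κ) := H.hlater e κ (lt_of_lt_of_le hj hκ)
      show R.tabB (Div.excEll e) (gov κ) i = R'.tabB (Div.excEll e) (gov κ) i
      rw [hE (gov κ) hlater i, hE' (gov κ) hlater i, hA κ i, hA' κ i]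
    · show R.tabS (Div.excEll e) s = R'.tabS (Div.excEll e) s
      rw [hES s, hES' s, hS s, hS' s]

/-- The infimum of Def. 6.7 is attained at the recorded `ρ`. Plumbing.
[cite: Hu2025, §6.2 Def. 6.5–6.9, pp. 99–106 (unrefereed preprint arXiv:2507.21400v1 under adjudication, D-0012/D-0089 — kernel support on OUR typed carrier of row 107; nothing of the source asserted)] -/
theorem attained {Q : ℕ → Prop} {n : ℕ} (h : (n : ℕ∞) = ⨅ (μ : ℕ) (_ : Q μ), (μ : ℕ∞)) : Q n := by
  by_contra hn
  have : ((n + 1 : ℕ) : ℕ∞) ≤ ⨅ (μ : ℕ) (_ : Q μ), (μ : ℕ∞) := by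
    refine le_iInf₂ fun μ hμ => ?_
    have hle : (n : ℕ∞) ≤ μ := by rw [h]; exact iInf₂_le μ hμ
    have hne : n ≠ μ := fun e => hn (e ▸ hμ)
    have : n < μ := lt_of_le_of_ne (by exact_mod_cast hle) hne
    exact_mod_cast this
  rw [← h] at this
  have : n + 1 ≤ n := by exact_mod_cast this
  omega

/-- (D) «`μ ≤ ρ_(kτ)`» transfers from `R` to `R'`, given agreement on all earlier rounds.
[cite: Hu2025, §6.2 Def. 6.5–6.9, pp. 99–106 (unrefereed preprint arXiv:2507.21400v1 under adjudication, D-0012/D-0089 — kernel support on OUR typed carrier of row 107; nothing of the source asserted)] -/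
theorem rho_ge_transfer (H : CanonHyp R R' ltP gov later meetsV) (kτ : W.IndexBgov) (μ : ℕ)
    (IH : ∀ kτ' μ', LexLT W (kτ', μ') (kτ, μ) → RoundAgree R R' gov kτ' μ')
    (h1 : 1 ≤ μ) (hμ : μ ≤ R.rho kτ) : μ ≤ R'.rho kτ := by
  -- the previous round is live for `R'`
  have hprev : μ - 1 ≤ R'.rho kτ :=
    (IH kτ (μ - 1) (Or.inr ⟨rfl, Or.inr ⟨rfl, by omega⟩⟩)).1.mp (by omega)
  -- an IH phrased for `μ - 1 + 1`
  have IH' : ∀ kτ' μ', LexLT W (kτ', μ') (kτ, μ - 1 + 1) → RoundAgree R R' gov kτ' μ' := by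
    rw [Nat.sub_add_cancel h1]; exact IH
  -- round `μ` of `R` has a ℘-set (else Def. 6.7's infimum would be `≤ μ - 1`)
  have hd := H.d kτ
  have hex : ∃ φ : PreWpSet W (W.divsBefore R.rho R.sigma kτ (μ - 1 + 1)) (R.col gov kτ),
      IsWpSet W (meetsV kτ (μ - 1)) φ := by
    by_contra hno
    push Not at hno
    have hle : (R.rho kτ : ℕ∞) ≤ ((μ - 1 : ℕ) : ℕ∞) := by
      rw [hd]; exact iInf₂_le (μ - 1) hno
    have : R.rho kτ ≤ μ - 1 := by exact_mod_cast hle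
    omega
  obtain ⟨φ, hφ⟩ := hex
  -- transport it to `R'`
  have h𝒟 := mem_divsBefore_iff kτ (μ - 1 + 1) IH'
  have hm : ∀ Y, Y ∈ W.divsBefore R.rho R.sigma kτ (μ - 1 + 1) → ∀ i, R.col gov kτ Y i = R'.col gov kτ Y i :=
    fun Y hY i => (col_agree H kτ _ IH' Y hY).1 kτ le_rfl i
  let φ' : PreWpSet W (W.divsBefore R'.rho R'.sigma kτ (μ - 1 + 1)) (R'.col gov kτ) :=
    PreWpSet.transfer (fun Y h => (h𝒟 Y).mp h) hm φ
  have hφ' : IsWpSet W (meetsV kτ (μ - 1)) φ' := hφ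
  -- hence `ρ'` is not `μ - 1`
  by_contra hlt
  have heq : R'.rho kτ = μ - 1 := by omega
  have hP := attained (H.symm.d kτ)
  rw [heq] at hP
  exact hP φ' hφ'

/-- (E) `σ_(kτ)μ` and the ℘-sets `ϕ_(kτ)μh` of a live round agree, given agreement on all earlier rounds; the two names
of each `ϕ_(kτ)μh` lie in `𝒟_{(℘_(kτ)𝔯_{μ−1})}`.
[cite: Hu2025, §6.2 Def. 6.5–6.9, pp. 99–106 (unrefereed preprint arXiv:2507.21400v1 under adjudication, D-0012/D-0089 — kernel support on OUR typed carrier of row 107; nothing of the source asserted)] -/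
theorem round_transfer (H : CanonHyp R R' ltP gov later meetsV) (kτ : W.IndexBgov) (μ : ℕ)
    (IH : ∀ kτ' μ', LexLT W (kτ', μ') (kτ, μ) → RoundAgree R R' gov kτ' μ')
    (h1 : 1 ≤ μ) (hμ : μ ≤ R.rho kτ) (hμ' : μ ≤ R'.rho kτ) :
    R.sigma kτ μ = R'.sigma kτ μ ∧
      ∀ h, 1 ≤ h → h ≤ R.sigma kτ μ →
        R.phi kτ μ h = R'.phi kτ μ h ∧
          (R.phi kτ μ h).1 ∈ W.divsBefore R.rho R.sigma kτ μ ∧ (R.phi kτ μ h).2 ∈ W.divsBefore R.rho R.sigma kτ μ := by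
  obtain ⟨L, hL, hlen, hphi⟩ := H.b kτ μ h1 hμ
  obtain ⟨L', hL', hlen', hphi'⟩ := H.symm.b kτ μ h1 hμ'
  have h𝒟 := mem_divsBefore_iff kτ μ IH
  have hm : ∀ Y, Y ∈ W.divsBefore R.rho R.sigma kτ μ → ∀ i, R.col gov kτ Y i = R'.col gov kτ Y i :=
    fun Y hY i => (col_agree H kτ μ IH Y hY).1 kτ le_rfl i
  have hLt := IsPhiListing.transfer ltP kτ (meetsV kτ (μ - 1)) h𝒟 hm hL
  have hEq := IsPhiListing.unique ltP H.hlt kτ (meetsV kτ (μ - 1)) hLt hL'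
  have hlenEq : L.length = L'.length := by rw [← hEq, List.length_map]
  refine ⟨by rw [← hlen, ← hlen', hlenEq], fun h hh1 hh => ?_⟩
  have hlt : h - 1 < L.length := by rw [hlen]; omega
  have hlt' : h - 1 < L'.length := by rw [← hlenEq]; exact hlt
  have e1 := hphi (h - 1) hlt
  have e2 := hphi' (h - 1) hlt'
  rw [Nat.sub_add_cancel hh1] at e1 e2
  have hget : (L'.get ⟨h - 1, hlt'⟩).plus = (L.get ⟨h - 1, hlt⟩).plus ∧
      (L'.get ⟨h - 1, hlt'⟩).minus = (L.get ⟨h - 1, hlt⟩).minus := by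
    subst hEq
    simp [List.getElem_map, PreWpSet.transfer_plus, PreWpSet.transfer_minus]
  refine ⟨by rw [e1, e2, hget.1, hget.2], ?_, ?_⟩
  · rw [e1]; exact (L.get ⟨h - 1, hlt⟩).plus_mem
  · rw [e1]; exact (L.get ⟨h - 1, hlt⟩).minus_mem

/-- The induction step: agreement on all lexicographically earlier rounds gives agreement on round `μ` of `B_(kτ)`.
[cite: Hu2025, §6.2 Def. 6.5–6.9, pp. 99–106 (unrefereed preprint arXiv:2507.21400v1 under adjudication, D-0012/D-0089 — kernel support on OUR typed carrier of row 107; nothing of the source asserted)] -/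
theorem step (H : CanonHyp R R' ltP gov later meetsV) (kτ : W.IndexBgov) (μ : ℕ)
    (IH : ∀ kτ' μ', LexLT W (kτ', μ') (kτ, μ) → RoundAgree R R' gov kτ' μ') : RoundAgree R R' gov kτ μ := by
  rcases Nat.eq_zero_or_pos μ with rfl | hpos
  · exact ⟨by simp, fun h => absurd h (by omega)⟩
  have IHs : ∀ kτ' μ', LexLT W (kτ', μ') (kτ, μ) → RoundAgree R' R gov kτ' μ' := fun kτ' μ' h => (IH kτ' μ' h).symm
  refine ⟨⟨rho_ge_transfer H kτ μ IH hpos, rho_ge_transfer H.symm kτ μ IHs hpos⟩, fun h1 hμ => ?_⟩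
  have hμ' : μ ≤ R'.rho kτ := rho_ge_transfer H kτ μ IH hpos hμ
  obtain ⟨hσ, hφ⟩ := round_transfer H kτ μ IH h1 hμ hμ'
  refine ⟨hσ, fun h hh1 hh => ?_⟩
  obtain ⟨hphi, hpm, hmm⟩ := hφ h hh1 hh
  -- Def. 6.6 at the new name, clause (c) of both runs
  have hidx : W.IsIndexPhi R.rho R.sigma kτ.1 (kτ.2.val + 1) μ h := ⟨kτ.2, rfl, h1, hμ, hh1, hh⟩
  have hidx' : W.IsIndexPhi R'.rho R'.sigma kτ.1 (kτ.2.val + 1) μ h := ⟨kτ.2, rfl, h1, hμ', hh1, hσ ▸ hh⟩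
  obtain ⟨hc, hcS⟩ := H.c kτ μ h hidx
  obtain ⟨hc', hcS'⟩ := H.symm.c kτ μ h hidx'
  have hcolp := col_agree H kτ μ IH _ hpm
  have hcolm := col_agree H kτ μ IH _ hmm
  refine ⟨hphi, fun κ hκ i => ?_, fun s => ?_⟩
  · rw [hc, hc', ← hphi]
    simp only [Def6_6_exc, Def6_6_lPhi, Def6_6_mPhi, hcolp.1 κ hκ, hcolm.1 κ hκ]
  · rw [hcS, hcS', ← hphi]
    simp only [Def6_6_excS, hcolp.2 s, hcolm.2 s]

/-- Every round agrees (nested strong induction on `(k, τ, μ)` in the lexicographic order).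
[cite: Hu2025, §6.2 Def. 6.5–6.9, pp. 99–106 (unrefereed preprint arXiv:2507.21400v1 under adjudication, D-0012/D-0089 — kernel support on OUR typed carrier of row 107; nothing of the source asserted)] -/
theorem all_roundAgree (H : CanonHyp R R' ltP gov later meetsV) (kτ : W.IndexBgov) (μ : ℕ) :
    RoundAgree R R' gov kτ μ := by
  suffices main : ∀ (k τ μ : ℕ) (kτ : W.IndexBgov), kτ.1.val = k → kτ.2.val = τ → RoundAgree R R' gov kτ μ from
    main _ _ μ kτ rfl rfl
  intro k
  refine Nat.strong_induction_on k ?_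
  intro k ihk τ
  refine Nat.strong_induction_on τ ?_
  intro τ ihτ μ
  refine Nat.strong_induction_on μ ?_
  intro μ ihμ kτ hk hτ
  refine step H kτ μ fun kτ' μ' hlex => ?_
  rcases hlex with hk' | ⟨hk', hτ' | ⟨hτ', hμ'⟩⟩
  · exact ihk kτ'.1.val (by rw [← hk]; exact hk') kτ'.2.val μ' kτ' rfl rfl
  · exact ihτ kτ'.2.val (by rw [← hτ]; exact hτ') μ' kτ' (by rw [← hk, hk']) rfl
  · exact ihμ μ' hμ' kτ' (by rw [← hk, hk']) (by rw [← hτ, hτ'])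

/-- **«canonical» (C43L131–L133) in the kernel: the tests determine the run.** If two runs are both as printed (same
asymmetric Plücker order, same `gov`, same scope `later` declaring the governing binomials of later blocks «later», same
tests), then `ρ_(kτ)` agree everywhere, and on every live round `σ_(kτ)μ` and all the ℘-centres `ϕ_(kτ)μh` agree — the
sequence of ℘-blow-ups of §6.2.1 AS TYPED is a function of the geometric tests alone. Certificate about the typed packaging
only. (Source: [Hu25] chunks p0043 l.92 – p0046 l.15.)
[cite: Hu2025, §6.2 Def. 6.5–6.9, pp. 99–106 (unrefereed preprint arXiv:2507.21400v1 under adjudication, D-0012/D-0089 — kernel support on OUR typed carrier of row 107; nothing of the source asserted)] -/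
theorem isAsPrinted_canonical (H : CanonHyp R R' ltP gov later meetsV) :
    R.rho = R'.rho ∧
      ∀ kτ μ, 1 ≤ μ → μ ≤ R.rho kτ →
        R.sigma kτ μ = R'.sigma kτ μ ∧ ∀ h, 1 ≤ h → h ≤ R.sigma kτ μ → R.phi kτ μ h = R'.phi kτ μ h := by
  have A := all_roundAgree H
  refine ⟨funext fun kτ => le_antisymm ((A kτ _).1.mp le_rfl) ((A kτ _).1.mpr le_rfl), fun kτ μ h1 hμ => ?_⟩
  obtain ⟨hσ, hh⟩ := (A kτ μ).2 h1 hμ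
  exact ⟨hσ, fun h hh1 hhσ => (hh h hh1 hhσ).1⟩

/-- **Corollary: the multiplicities the construction reads agree too** — at every new name `E_{(kτ)μh}` of a live round,
the two runs' tables coincide in every column `gov κ` of a block `κ.1 ≥ kτ.1` and in the whole `s`-table (the other entries
are not read by §6.2 and not claimed).
[cite: Hu2025, §6.2 Def. 6.5–6.9, pp. 99–106 (unrefereed preprint arXiv:2507.21400v1 under adjudication, D-0012/D-0089 — kernel support on OUR typed carrier of row 107; nothing of the source asserted)] -/
theorem isAsPrinted_canonical_tables (H : CanonHyp R R' ltP gov later meetsV) (kτ : W.IndexBgov) (μ h : ℕ)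
    (h1 : 1 ≤ μ) (hμ : μ ≤ R.rho kτ) (hh1 : 1 ≤ h) (hh : h ≤ R.sigma kτ μ) :
    (∀ κ : W.IndexBgov, kτ.1 ≤ κ.1 → ∀ i,
        R.tabB (Div.excWpOf kτ μ h) (gov κ) i = R'.tabB (Div.excWpOf kτ μ h) (gov κ) i) ∧
      ∀ s, R.tabS (Div.excWpOf kτ μ h) s = R'.tabS (Div.excWpOf kτ μ h) s :=
  ((all_roundAgree H kτ μ).2 h1 hμ).2 h hh1 hh |>.2

end Main

/-! ## Consequences for ONE run (API for the consumers of `WpRun.IsAsPrinted`, rows 108/110) -/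

section OneRun

variable [DecidableEq P] [DecidableEq Λ]
variable {R : W.WpRun Bin} {ltP : P → P → Prop} {gov : W.IndexBgov → Bin} {later : Fin W.N → Bin → Prop}
  {meetsV : W.IndexBgov → ℕ → W.Div → W.Div → Prop}

/-- Def. 6.7 AS TYPED, unfolded: NO pre-℘-set of round `ρ_(kτ)+1` passes the test (the infimum is attained).
[cite: Hu2025, §6.2 Def. 6.5–6.9, pp. 99–106 (unrefereed preprint arXiv:2507.21400v1 under adjudication, D-0012/D-0089 — kernel support on OUR typed carrier of row 107; nothing of the source asserted)] -/
theorem WpRun.IsAsPrinted.rho_spec (hR : R.IsAsPrinted ltP gov later meetsV) (kτ : W.IndexBgov) :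
    ∀ φ : PreWpSet W (W.divsBefore R.rho R.sigma kτ (R.rho kτ + 1)) (R.col gov kτ),
      ¬ IsWpSet W (meetsV kτ (R.rho kτ)) φ :=
  attained (hR.2.2.2.1 kτ)

/-- Every live round `1 ≤ μ ≤ ρ_(kτ)` HAS a ℘-set (minimality in Def. 6.7 AS TYPED).
[cite: Hu2025, §6.2 Def. 6.5–6.9, pp. 99–106 (unrefereed preprint arXiv:2507.21400v1 under adjudication, D-0012/D-0089 — kernel support on OUR typed carrier of row 107; nothing of the source asserted)] -/
theorem WpRun.IsAsPrinted.round_has_wpSet (hR : R.IsAsPrinted ltP gov later meetsV) (kτ : W.IndexBgov) {μ : ℕ} (h1 : 1 ≤ μ)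
    (hμ : μ ≤ R.rho kτ) :
    ∃ φ : PreWpSet W (W.divsBefore R.rho R.sigma kτ μ) (R.col gov kτ), IsWpSet W (meetsV kτ (μ - 1)) φ := by
  have hd := hR.2.2.2.1 kτ
  have hex : ∃ φ : PreWpSet W (W.divsBefore R.rho R.sigma kτ (μ - 1 + 1)) (R.col gov kτ),
      IsWpSet W (meetsV kτ (μ - 1)) φ := by
    by_contra hno
    push Not at hno
    have hle : (R.rho kτ : ℕ∞) ≤ ((μ - 1 : ℕ) : ℕ∞) := by
      rw [hd]; exact iInf₂_le (μ - 1) hno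
    have : R.rho kτ ≤ μ - 1 := by exact_mod_cast hle
    omega
  rw [Nat.sub_add_cancel h1] at hex
  exact hex

/-- Hence `σ_(kτ)μ ≥ 1` on every live round («for some finite positive integer σ_(kτ)μ», C44L32).
[cite: Hu2025, §6.2 Def. 6.5–6.9, pp. 99–106 (unrefereed preprint arXiv:2507.21400v1 under adjudication, D-0012/D-0089 — kernel support on OUR typed carrier of row 107; nothing of the source asserted)] -/
theorem WpRun.IsAsPrinted.sigma_pos (hR : R.IsAsPrinted ltP gov later meetsV) (kτ : W.IndexBgov) {μ : ℕ} (h1 : 1 ≤ μ)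
    (hμ : μ ≤ R.rho kτ) : 1 ≤ R.sigma kτ μ := by
  obtain ⟨L, hL, hlen, -⟩ := hR.2.1 kτ μ h1 hμ
  obtain ⟨φ, hφ⟩ := hR.round_has_wpSet kτ h1 hμ
  obtain ⟨ψ, hψ, -, -⟩ := (hL.1 φ).mp hφ
  rw [← hlen]
  exact List.length_pos_of_mem hψ

/-- The listed centres are ℘-sets: `ϕ_(kτ)μh` passes the test of its round and its two names lie in `𝒟_{(℘_(kτ)𝔯_{μ−1})}`.
[cite: Hu2025, §6.2 Def. 6.5–6.9, pp. 99–106 (unrefereed preprint arXiv:2507.21400v1 under adjudication, D-0012/D-0089 — kernel support on OUR typed carrier of row 107; nothing of the source asserted)] -/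
theorem WpRun.IsAsPrinted.phi_spec (hR : R.IsAsPrinted ltP gov later meetsV) (kτ : W.IndexBgov) {μ h : ℕ} (h1 : 1 ≤ μ)
    (hμ : μ ≤ R.rho kτ) (hh1 : 1 ≤ h) (hh : h ≤ R.sigma kτ μ) :
    meetsV kτ (μ - 1) (R.phi kτ μ h).1 (R.phi kτ μ h).2 ∧
      (R.phi kτ μ h).1 ∈ W.divsBefore R.rho R.sigma kτ μ ∧ (R.phi kτ μ h).2 ∈ W.divsBefore R.rho R.sigma kτ μ := by
  obtain ⟨L, hL, hlen, hphi⟩ := hR.2.1 kτ μ h1 hμ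
  have hlt : h - 1 < L.length := by rw [hlen]; omega
  have e := hphi (h - 1) hlt
  rw [Nat.sub_add_cancel hh1] at e
  have hmem : L.get ⟨h - 1, hlt⟩ ∈ L := List.get_mem L _
  have hwp : IsWpSet W (meetsV kτ (μ - 1)) (L.get ⟨h - 1, hlt⟩) := (hL.1 _).mpr ⟨_, hmem, rfl, rfl⟩
  rw [e]
  exact ⟨hwp, (L.get ⟨h - 1, hlt⟩).plus_mem, (L.get ⟨h - 1, hlt⟩).minus_mem⟩

end OneRun

/-! ## Existence of the listing (C44L28 «Thus, we can list Φ_{℘_(kτ)𝔯_μ} as {ϕ_(kτ)μ1 < ⋯ < ϕ_(kτ)μσ}»)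

Def. 6.5's order is also TRANSITIVE (given a transitive Plücker order), so on a finite set of ℘-sets on which it is
trichotomous an increasing enumeration exists; with `IsPhiListing.unique` the listing of a round is well defined AS TYPED. -/

section Listing

variable {P : Type v₁} {Λ : Type v₁} {W : WpFrame P Λ}

/-- Nothing precedes the initial stage. Plumbing.
[cite: Hu2025, §6.2 Def. 6.5–6.9, pp. 99–106 (unrefereed preprint arXiv:2507.21400v1 under adjudication, D-0012/D-0089 — kernel support on OUR typed carrier of row 107; nothing of the source asserted)] -/
theorem Stage.not_LT_init (c : W.Stage) : ¬ Stage.LT c Stage.init := by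
  rcases c with u | x | k <;> simp [Stage.LT, Stage.init]

/-- «order of occurrence» is transitive.
[cite: Hu2025, §6.2 Def. 6.5–6.9, pp. 99–106 (unrefereed preprint arXiv:2507.21400v1 under adjudication, D-0012/D-0089 — kernel support on OUR typed carrier of row 107; nothing of the source asserted)] -/
theorem Div.occLT_trans {Y Y' Y'' : W.Div} (h : Div.OccLT Y Y') (h' : Div.OccLT Y' Y'') : Div.OccLT Y Y'' := by
  obtain ⟨a, b, ha, hb, hab⟩ := h
  obtain ⟨b', c, hb', hc, hbc⟩ := h'
  have eb : b' = b := Option.some.inj (hb'.symm.trans hb)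
  subst eb
  refine ⟨a, c, ha, hc, ?_⟩
  rcases hab with hab | ⟨rfl, rfl, j, j', hY, hY', hjj⟩
  · rcases hbc with hbc | ⟨hb0, rfl, i, i', -, -, -⟩
    · exact Or.inl (Stage.LT_trans _ _ _ hab hbc)
    · rw [hb0] at hab; exact (Stage.not_LT_init _ hab).elim
  · rcases hbc with hbc | ⟨-, hc0, i, i', hY'i, hY''i', hii⟩
    · exact Or.inl hbc
    · refine Or.inr ⟨rfl, hc0, j, i', hY, hY''i', ?_⟩
      have e : j' = i := by
        have := hY'.symm.trans hY'i; simpa [Div.excTheta] using this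
      subst e
      exact lt_trans hjj hii

/-- Exceptional names are neither `X_{(u_s,v_s)}` nor `X_{u_k}`. Plumbing.
[cite: Hu2025, §6.2 Def. 6.5–6.9, pp. 99–106 (unrefereed preprint arXiv:2507.21400v1 under adjudication, D-0012/D-0089 — kernel support on OUR typed carrier of row 107; nothing of the source asserted)] -/
theorem Div.ne_varrho_of_isExceptional {Y : W.Div} (h : Div.IsExceptional Y) (r : Λ) : Y ≠ Div.varrho r := by
  rintro rfl; simp [Div.IsExceptional, Div.cases, Div.varrho] at h

/-- Exceptional names are not ϖ-names. Plumbing.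
[cite: Hu2025, §6.2 Def. 6.5–6.9, pp. 99–106 (unrefereed preprint arXiv:2507.21400v1 under adjudication, D-0012/D-0089 — kernel support on OUR typed carrier of row 107; nothing of the source asserted)] -/
theorem Div.ne_varpi_of_isExceptional {Y : W.Div} (h : Div.IsExceptional Y) (u : P) : Y ≠ Div.varpi u := by
  rintro rfl; simp [Div.IsExceptional, Div.cases, Div.varpi] at h

/-- Def. 6.5's order on `𝒟⁺` is transitive.
[cite: Hu2025, §6.2 Def. 6.5–6.9, pp. 99–106 (unrefereed preprint arXiv:2507.21400v1 under adjudication, D-0012/D-0089 — kernel support on OUR typed carrier of row 107; nothing of the source asserted)] -/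
theorem Def6_5_plusLT_trans (kτ : W.IndexBgov) {Y Y' Y'' : W.Div} (h : W.Def6_5_plusLT kτ Y Y')
    (h' : W.Def6_5_plusLT kτ Y' Y'') : W.Def6_5_plusLT kτ Y Y'' := by
  rcases h' with ⟨h1', h2'⟩ | ⟨h1', h2', h3'⟩ | ⟨hy', hy'', ho'⟩
  · -- `Y'' = X_{(u_s,v_s)}`
    refine Or.inl ⟨h1', ?_⟩
    rcases h with ⟨h1, h2⟩ | ⟨h1, h2, h3⟩ | ⟨hx, hx', ho⟩
    · exact (h2' (h1.trans h1'.symm)).elim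
    · rw [h1']; exact h3
    · rw [h1']; exact Div.ne_varrho_of_isExceptional hx _
  · -- `Y'' = X_{u_k}`
    refine Or.inr (Or.inl ⟨h1', ?_, ?_⟩)
    · rcases h with ⟨h1, -⟩ | ⟨h1, -, -⟩ | ⟨hx, -, -⟩
      · exact (h3' h1).elim
      · exact (h2' (h1.trans h1'.symm)).elim
      · rw [h1']; exact Div.ne_varpi_of_isExceptional hx _
    · rcases h with ⟨h1, -⟩ | ⟨h1, -, -⟩ | ⟨hx, -, -⟩
      · exact (h3' h1).elim
      · exact (h2' (h1.trans h1'.symm)).elim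
      · exact Div.ne_varrho_of_isExceptional hx _
  · -- both exceptional
    rcases h with ⟨h1, -⟩ | ⟨h1, -, -⟩ | ⟨hx, -, ho⟩
    · exact (Div.ne_varrho_of_isExceptional hy' _ h1).elim
    · exact (Div.ne_varpi_of_isExceptional hy' _ h1).elim
    · exact Or.inr (Or.inr ⟨hx, hy'', Div.occLT_trans ho' ho⟩)

/-- Def. 6.5's order on `𝒟⁻` is transitive, given a transitive Plücker order.
[cite: Hu2025, §6.2 Def. 6.5–6.9, pp. 99–106 (unrefereed preprint arXiv:2507.21400v1 under adjudication, D-0012/D-0089 — kernel support on OUR typed carrier of row 107; nothing of the source asserted)] -/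
theorem Def6_5_minusLT_trans (ltP : P → P → Prop) (hltT : ∀ u u' u'', ltP u u' → ltP u' u'' → ltP u u'')
    {Y Y' Y'' : W.Div} (h : W.Def6_5_minusLT ltP Y Y') (h' : W.Def6_5_minusLT ltP Y' Y'') :
    W.Def6_5_minusLT ltP Y Y'' := by
  rcases h with ⟨hx, hx', ho⟩ | ⟨hx, hv'⟩ | ⟨u, u', hu, hu', huu⟩ <;>
    rcases h' with ⟨hy', hy'', ho'⟩ | ⟨hy', hv''⟩ | ⟨w', w'', hw', hw'', hww⟩
  · exact Or.inl ⟨hx, hy'', Div.occLT_trans ho' ho⟩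
  · exact Or.inr (Or.inl ⟨hx, hv''⟩)
  · exact (Div.isVarpi_isExceptional (by rw [hw']; exact Div.isVarpi_varpi w') hx').elim
  · exact (Div.isVarpi_isExceptional hv' hy').elim
  · exact (Div.isVarpi_isExceptional hv' hy').elim
  · exact Or.inr (Or.inl ⟨hx, by rw [hw'']; exact Div.isVarpi_varpi w''⟩)
  · exact (Div.isVarpi_isExceptional (by rw [hu']; exact Div.isVarpi_varpi u') hy').elim
  · exact (Div.isVarpi_isExceptional (by rw [hu']; exact Div.isVarpi_varpi u') hy').elim
  · have e : u' = w' := Div.varpi_inj (hu'.symm.trans hw')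
    subst e
    exact Or.inr (Or.inr ⟨u, w'', hu, hw'', hltT _ _ _ huu hww⟩)

/-- Def. 6.5's order on the ℘-sets is transitive, given a transitive Plücker order.
[cite: Hu2025, §6.2 Def. 6.5–6.9, pp. 99–106 (unrefereed preprint arXiv:2507.21400v1 under adjudication, D-0012/D-0089 — kernel support on OUR typed carrier of row 107; nothing of the source asserted)] -/
theorem Def6_5_phiLT_trans (ltP : P → P → Prop) (hltT : ∀ u u' u'', ltP u u' → ltP u' u'' → ltP u u'')
    (kτ : W.IndexBgov) {𝒟 : Set W.Div} {m : W.Div → Fin 2 → ℕ} {φ₁ φ₂ φ₃ : PreWpSet W 𝒟 m}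
    (h : W.Def6_5_phiLT ltP kτ φ₁ φ₂) (h' : W.Def6_5_phiLT ltP kτ φ₂ φ₃) : W.Def6_5_phiLT ltP kτ φ₁ φ₃ := by
  rcases h with h | ⟨he, h⟩ <;> rcases h' with h' | ⟨he', h'⟩
  · exact Or.inl (W.Def6_5_plusLT_trans kτ h h')
  · exact Or.inl (he' ▸ h)
  · exact Or.inl (he ▸ h')
  · exact Or.inr ⟨he.trans he', W.Def6_5_minusLT_trans ltP hltT h h'⟩

/-- A finite list on which a transitive, irreflexive relation is trichotomous has an `r`-least member. Plumbing.
[cite: Hu2025, §6.2 Def. 6.5–6.9, pp. 99–106 (unrefereed preprint arXiv:2507.21400v1 under adjudication, D-0012/D-0089 — kernel support on OUR typed carrier of row 107; nothing of the source asserted)] -/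
theorem list_exists_least {α : Type*} (r : α → α → Prop) (hirr : ∀ a, ¬ r a a)
    (htr : ∀ a b c, r a b → r b c → r a c) :
    ∀ (l : List α), l ≠ [] → (∀ a ∈ l, ∀ b ∈ l, a ≠ b → r a b ∨ r b a) →
      ∃ a ∈ l, ∀ b ∈ l, b ≠ a → r a b
  | [], h, _ => (h rfl).elim
  | [a], _, _ => ⟨a, by simp, fun b hb hne => by simp at hb; exact (hne hb).elim⟩
  | a :: b :: l, _, htot => by
    obtain ⟨c, hc, hmin⟩ := list_exists_least r hirr htr (b :: l) (by simp)
      (fun x hx y hy hne => htot x (List.mem_cons_of_mem a hx) y (List.mem_cons_of_mem a hy) hne)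
    by_cases hac : a = c
    · subst hac
      exact ⟨a, by simp, fun y hy hne => by
        rcases List.mem_cons.mp hy with rfl | hy
        · exact (hne rfl).elim
        · exact hmin y hy hne⟩
    rcases htot a (by simp) c (List.mem_cons_of_mem a hc) hac with hlt | hlt
    · refine ⟨a, by simp, fun y hy hne => ?_⟩
      rcases List.mem_cons.mp hy with rfl | hy
      · exact (hne rfl).elim
      · by_cases hyc : y = c
        · subst hyc; exact hlt
        · exact htr _ _ _ hlt (hmin y hy hyc)
    · exact ⟨c, List.mem_cons_of_mem a hc, fun y hy hne => by
        rcases List.mem_cons.mp hy with rfl | hy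
        · exact hlt
        · exact hmin y hy hne⟩

/-- Sorting: a finite duplicate-free list on which `r` is a strict total order has an `r`-increasing re-enumeration.
Plumbing.
[cite: Hu2025, §6.2 Def. 6.5–6.9, pp. 99–106 (unrefereed preprint arXiv:2507.21400v1 under adjudication, D-0012/D-0089 — kernel support on OUR typed carrier of row 107; nothing of the source asserted)] -/
theorem list_exists_chain {α : Type*} [DecidableEq α] (r : α → α → Prop) (hirr : ∀ a, ¬ r a a)
    (htr : ∀ a b c, r a b → r b c → r a c) :
    ∀ (n : ℕ) (l : List α), l.length = n → l.Nodup → (∀ a ∈ l, ∀ b ∈ l, a ≠ b → r a b ∨ r b a) →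
      ∃ L : List α, L.Pairwise r ∧ ∀ a, a ∈ L ↔ a ∈ l
  | 0, l, hl, _, _ => ⟨[], List.Pairwise.nil, fun a => by rw [List.length_eq_zero_iff.mp hl]⟩
  | n + 1, l, hl, hnd, htot => by
    have hne : l ≠ [] := by rintro rfl; simp at hl
    obtain ⟨a, ha, hmin⟩ := list_exists_least r hirr htr l hne htot
    have hlen : (l.erase a).length = n := by rw [List.length_erase_of_mem ha, hl]; rfl
    obtain ⟨L, hL, hmem⟩ := list_exists_chain r hirr htr n (l.erase a) hlen (hnd.erase a)
      (fun x hx y hy hxy => htot x (List.mem_of_mem_erase hx) y (List.mem_of_mem_erase hy) hxy)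
    refine ⟨a :: L, List.pairwise_cons.mpr ⟨fun b hb => ?_, hL⟩, fun x => ?_⟩
    · have hb' : b ∈ l.erase a := (hmem b).mp hb
      have hba : b ≠ a := fun e => by subst e; exact (List.Nodup.not_mem_erase hnd) hb'
      exact hmin b (List.mem_of_mem_erase hb') hba
    · rw [List.mem_cons, hmem]
      constructor
      · rintro (rfl | hx)
        · exact ha
        · exact List.mem_of_mem_erase hx
      · intro hx
        by_cases hxa : x = a
        · exact Or.inl hxa
        · exact Or.inr ((List.mem_erase_of_ne hxa).mpr hx)

/-- **The listing of a round EXISTS** (C44L28 «Thus, we can list Φ_{℘_(kτ)𝔯_μ} as …») whenever the name set is finite, the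
Plücker order is asymmetric and transitive, and Def. 6.5's order compares any two distinct ℘-sets of the round (for a run with
Def. 6.1's initial package this is `C44L6_of_initial`/`C44L20_of_initial`). Together with `IsPhiListing.unique`: the listing is
well defined AS TYPED.
[cite: Hu2025, §6.2 Def. 6.5–6.9, pp. 99–106 (unrefereed preprint arXiv:2507.21400v1 under adjudication, D-0012/D-0089 — kernel support on OUR typed carrier of row 107; nothing of the source asserted)] -/
theorem exists_isPhiListing (ltP : P → P → Prop) (hltA : ∀ u u', ltP u u' → ¬ ltP u' u)
    (hltT : ∀ u u' u'', ltP u u' → ltP u' u'' → ltP u u'') (kτ : W.IndexBgov)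
    {𝒟 : Set W.Div} (h𝒟 : 𝒟.Finite) {m : W.Div → Fin 2 → ℕ} (meetsV : W.Div → W.Div → Prop)
    (htot : ∀ φ ψ : PreWpSet W 𝒟 m, IsWpSet W meetsV φ → IsWpSet W meetsV ψ → φ ≠ ψ →
      W.Def6_5_phiLT ltP kτ φ ψ ∨ W.Def6_5_phiLT ltP kτ ψ φ) :
    ∃ L : List (PreWpSet W 𝒟 m), W.IsPhiListing ltP kτ meetsV L := by
  classical
  have hfin : {φ : PreWpSet W 𝒟 m | IsWpSet W meetsV φ}.Finite := C43L126_holds W 𝒟 m meetsV h𝒟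
  obtain ⟨s, hs⟩ := hfin.exists_finset_coe
  let r : PreWpSet W 𝒟 m → PreWpSet W 𝒟 m → Prop :=
    fun φ₁ φ₂ => W.Def6_5_phiLT ltP kτ φ₁ φ₂ ∧ ¬ (φ₁.plus = φ₂.plus ∧ φ₁.minus = φ₂.minus)
  have hirr : ∀ a, ¬ r a a := fun a h => h.2 ⟨rfl, rfl⟩
  have htr : ∀ a b c, r a b → r b c → r a c := by
    intro a b c hab hbc
    refine ⟨W.Def6_5_phiLT_trans ltP hltT kτ hab.1 hbc.1, fun he => ?_⟩
    have e : a = c := PreWpSet.ext' W he.1 he.2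
    subst e
    exact W.Def6_5_phiLT_asymm ltP hltA kτ hab.1 hbc.1
  have hmem : ∀ φ, φ ∈ s.toList ↔ IsWpSet W meetsV φ := by
    intro φ
    rw [Finset.mem_toList, ← Finset.mem_coe, hs]
    rfl
  have htot' : ∀ a ∈ s.toList, ∀ b ∈ s.toList, a ≠ b → r a b ∨ r b a := by
    intro a ha b hb hab
    have hne : ¬ (a.plus = b.plus ∧ a.minus = b.minus) := fun he => hab (PreWpSet.ext' W he.1 he.2)
    have hne' : ¬ (b.plus = a.plus ∧ b.minus = a.minus) := fun he => hab (PreWpSet.ext' W he.1.symm he.2.symm)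
    rcases htot a b ((hmem a).mp ha) ((hmem b).mp hb) hab with h | h
    · exact Or.inl ⟨h, hne⟩
    · exact Or.inr ⟨h, hne'⟩
  obtain ⟨L, hL, hLmem⟩ := list_exists_chain r hirr htr _ s.toList rfl (Finset.nodup_toList s) htot'
  refine ⟨L, fun φ => ?_, hL⟩
  rw [← hmem, ← hLmem]
  constructor
  · intro h; exact ⟨φ, h, rfl, rfl⟩
  · rintro ⟨ψ, hψ, h1, h2⟩
    have : ψ = φ := PreWpSet.ext' W h1 h2
    rw [← this]; exact hψ


/-- **Def. 6.5's listing is well defined for a run with Def. 6.1's initial package**: if the Plücker order is a strict total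
order (asymmetric, transitive, comparing distinct indices — Def. 3.14/3.15, row 102) and the name set `𝒟_{(℘_(kτ)𝔯_{μ−1})}` is
finite (C43L123–L125), then the ℘-sets of round `μ` of `B_(kτ)` admit an increasing enumeration (by `C44L6_of_initial` /
`C44L20_of_initial` any two distinct ℘-sets compare), unique by `IsPhiListing.unique`.
[cite: Hu2025, §6.2 Def. 6.5–6.9, pp. 99–106 (unrefereed preprint arXiv:2507.21400v1 under adjudication, D-0012/D-0089 — kernel support on OUR typed carrier of row 107; nothing of the source asserted)] -/
theorem exists_isPhiListing_of_initial [DecidableEq P] [DecidableEq Λ] {Bin : Type w₁} (R : W.WpRun Bin)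
    (gov : W.IndexBgov → Bin) (ltP : P → P → Prop) (hltA : ∀ u u', ltP u u' → ¬ ltP u' u)
    (hltT : ∀ u u' u'', ltP u u' → ltP u' u'' → ltP u u'') (hltTot : ∀ u u' : P, u ≠ u' → ltP u u' ∨ ltP u' u)
    (hinit : ∀ Y ∈ W.divsTheta, ∀ kτ i, R.tabB Y (gov kτ) i = Def6_1 W Y kτ i) (kτ : W.IndexBgov) (μ : ℕ)
    (h𝒟 : (W.divsBefore R.rho R.sigma kτ μ).Finite) (meetsV : W.Div → W.Div → Prop) :
    ∃ L : List (PreWpSet W (W.divsBefore R.rho R.sigma kτ μ) (R.col gov kτ)), W.IsPhiListing ltP kτ meetsV L := by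
  refine exists_isPhiListing ltP hltA hltT kτ h𝒟 meetsV fun φ ψ _ _ hne => ?_
  have h6 := (C44L6_of_initial W R gov hinit kτ μ).2
  have h20 := (C44L20_of_initial W R gov ltP hltTot hinit kτ μ).2
  by_cases hp : φ.plus = ψ.plus
  · have hm : φ.minus ≠ ψ.minus := fun e => hne (PreWpSet.ext' W hp e)
    rcases h20 φ.minus φ.minus_mem ψ.minus ψ.minus_mem φ.minus_assoc ψ.minus_assoc hm with h | h
    · exact Or.inl (Or.inr ⟨hp, h⟩)
    · exact Or.inr (Or.inr ⟨hp.symm, h⟩)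
  · rcases h6 φ.plus φ.plus_mem ψ.plus ψ.plus_mem φ.plus_assoc ψ.plus_assoc hp with h | h
    · exact Or.inl (Or.inl h)
    · exact Or.inr (Or.inl h)

end Listing

end WpFrame

end Literature.AlgebraicGeometry.Hu2025.Statements.S06WpEllBlowups
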